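import Summits.MatrixMultiplication.OmegaCensus.SmallFormats.InvertiblePointNearEtaSpecial
import Summits.MatrixMultiplication.OmegaCensus.SmallFormats.InvertiblePointNearDeadColumn
import HarnessLib

/-!
# ω-census family (a): `2 × 2` lemmas on η-special functionals (support file for `InvertiblePointNearEtaCaseB`)

Cell `pub-omega` (unit `pub-omega-tensor-g26`), topic `Summits/MatrixMultiplication/OmegaCensus` (sub-folder `SmallFormats`).
Framing (verbatim): lottery ticket; floor = certified bounds/negative ranges. HONEST FRAMING: elementary linear algebra on `k²` and `k^{2×2}`
over an arbitrary field: for a nonzero functional `η` on `k²`, the vector `m = (η(e₁), −η(e₀))` spans `ker η` (`kerVec_spec`,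
`exists_smul_of_eta_eq_zero`), `(e_i e_jᵀ) u = u_j e_i` (`single_one_mulVec`), and the annihilator of the plane `{m λᵀ : λ ∈ k²}` inside
`(k^{2×2})*` is exactly the set of η-SPECIAL functionals `X ↦ η(X u)` (`etaSpecial_of_forall_vecMulVec_eq_zero`; contrapositive
`exists_vecMulVec_apply_ne_zero`). Used by the kernel form of desk law §8(a) of `NEAR-STRUCTURE.md`. Nothing on `ω`.
-/

namespace Summit.MatrixMultiplication.OmegaCensus.SmallFormats

open Module Matrix Literature.Computability.AlgebraicComplexity

variable {k : Type*} [Field k]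

section FinTwo

/-- A nonzero functional on `k²` takes the value `1`. -/
theorem exists_apply_eq_one_of_ne_zero (η : Module.Dual k (Fin 2 → k)) (hη : η ≠ 0) : ∃ w₀ : Fin 2 → k, η w₀ = 1 := by
  obtain ⟨w₁, hw₁⟩ : ∃ w, η w ≠ 0 := by
    by_contra h
    push Not at h
    exact hη (LinearMap.ext h)
  exact ⟨(η w₁)⁻¹ • w₁, by rw [map_smul, smul_eq_mul, inv_mul_cancel₀ hw₁]⟩

/-- The vector `m := (η(e₁), −η(e₀))` spans `ker η` for a nonzero functional `η` on `k²`: it is nonzero and `η(m) = 0`. -/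
theorem kerVec_spec (η : Module.Dual k (Fin 2 → k)) (hη : η ≠ 0) :
    (![η (Pi.single 1 1), -η (Pi.single 0 1)] : Fin 2 → k) ≠ 0 ∧ η ![η (Pi.single 1 1), -η (Pi.single 0 1)] = 0 := by
  constructor
  · intro h
    apply hη
    apply LinearMap.ext
    intro w
    have h0 : η (Pi.single 0 1) = 0 := by
      have := congr_fun h 1; simpa using this
    have h1 : η (Pi.single 1 1) = 0 := by
      have := congr_fun h 0; simpa using this
    have hw : w = w 0 • (Pi.single 0 1 : Fin 2 → k) + w 1 • (Pi.single 1 1 : Fin 2 → k) := by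
      funext r; fin_cases r <;> simp
    rw [hw, map_add, map_smul, map_smul, h0, h1, smul_zero, smul_zero, add_zero, LinearMap.zero_apply]
  · have hm : (![η (Pi.single 1 1), -η (Pi.single 0 1)] : Fin 2 → k) =
        η (Pi.single 1 1) • (Pi.single 0 1 : Fin 2 → k) + (-η (Pi.single 0 1)) • (Pi.single 1 1 : Fin 2 → k) := by
      funext r; fin_cases r <;> simp
    rw [hm, map_add, map_smul, map_smul, smul_eq_mul, smul_eq_mul]; ring

/-- `ker η` is the line `k·m`: if `η(m) = 0`, `m ≠ 0` and `η(c) = 0` then `c ∈ k·m`. -/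
theorem exists_smul_of_eta_eq_zero (η : Module.Dual k (Fin 2 → k)) (hη : η ≠ 0) {mv : Fin 2 → k} (hm0 : mv ≠ 0)
    (hηm : η mv = 0) (c : Fin 2 → k) (hc : η c = 0) : ∃ t : k, c = t • mv := by
  apply exists_smul_of_cross_eq_zero hm0
  have hdec : ∀ w : Fin 2 → k, η w = w 0 * η (Pi.single 0 1) + w 1 * η (Pi.single 1 1) := by
    intro w
    have hw : w = w 0 • (Pi.single 0 1 : Fin 2 → k) + w 1 • (Pi.single 1 1 : Fin 2 → k) := by
      funext r; fin_cases r <;> simp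
    conv_lhs => rw [hw]
    rw [map_add, map_smul, map_smul, smul_eq_mul, smul_eq_mul]
  have h1 := hdec mv
  have h2 := hdec c
  rw [hηm] at h1
  rw [hc] at h2
  -- some `η(e_i) ≠ 0`
  by_cases h0 : η (Pi.single 0 1) = 0
  · have h1' : η (Pi.single 1 1) ≠ 0 := by
      intro h1'
      apply hη; apply LinearMap.ext; intro w; rw [hdec w, h0, h1', mul_zero, mul_zero, add_zero, LinearMap.zero_apply]
    have a : mv 1 = 0 := by
      rw [h0, mul_zero, zero_add] at h1
      rcases mul_eq_zero.mp h1.symm with h | h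
      · exact h
      · exact absurd h h1'
    have b : c 1 = 0 := by
      rw [h0, mul_zero, zero_add] at h2
      rcases mul_eq_zero.mp h2.symm with h | h
      · exact h
      · exact absurd h h1'
    rw [a, b, mul_zero, zero_mul, sub_zero]
  · have key : η (Pi.single 0 1) * (mv 0 * c 1 - mv 1 * c 0) = 0 := by
      linear_combination c 1 * h1.symm - mv 1 * h2.symm
    rcases mul_eq_zero.mp key with h | h
    · exact absurd h h0
    · exact h

/-- `(e_i e_jᵀ) u = u_j e_i` (any column index type). -/
theorem single_one_mulVec {m' : Type*} [Fintype m'] [DecidableEq m'] (i : Fin 2) (j : m') (u : m' → k) :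
    single i j (1 : k) *ᵥ u = u j • (Pi.single i 1 : Fin 2 → k) := by
  rw [Matrix.single_mulVec, one_mul]
  funext r
  simp only [Function.update_apply, Pi.zero_apply, Pi.smul_apply, Pi.single_apply, smul_eq_mul, mul_ite, mul_one, mul_zero]

/-- **The annihilator of `{m λᵀ}` is `R_η`.** If `η ≠ 0`, `m` spans `ker η`, and a functional `φ` on `k^{2×2}` kills every `m λᵀ`, then `φ`
is η-special: `φ(X) = η(X u)` with `u_j := φ(w₀ e_jᵀ)`, `η(w₀) = 1`. -/
theorem etaSpecial_of_forall_vecMulVec_eq_zero (η : Module.Dual k (Fin 2 → k)) (hη : η ≠ 0) {mv : Fin 2 → k} (hm0 : mv ≠ 0)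
    (hηm : η mv = 0) (φ : Module.Dual k (Matrix (Fin 2) (Fin 2) k)) (hφ : ∀ lam : Fin 2 → k, φ (vecMulVec mv lam) = 0) :
    ∃ u : Fin 2 → k, ∀ X, φ X = η (X *ᵥ u) := by
  obtain ⟨w₀, hw₀⟩ := exists_apply_eq_one_of_ne_zero η hη
  set u : Fin 2 → k := fun j => φ (vecMulVec w₀ (Pi.single j 1)) with hu
  refine ⟨u, fun X => ?_⟩
  -- both sides are linear in `X`; compare on the unit matrices `single i j 1 = e_i e_jᵀ`, `e_i = η(e_i) w₀ + t m`
  have hsingle : ∀ i j : Fin 2, φ (single i j 1) = η (single i j (1 : k) *ᵥ u) := by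
    intro i j
    obtain ⟨t, ht⟩ := exists_smul_of_eta_eq_zero η hη hm0 hηm ((Pi.single i 1 : Fin 2 → k) - η (Pi.single i 1) • w₀)
      (by rw [map_sub, map_smul, hw₀, smul_eq_mul, mul_one, sub_self])
    have hei : (Pi.single i 1 : Fin 2 → k) = η (Pi.single i 1) • w₀ + t • mv := by rw [← ht]; abel
    have hmat : single i j (1 : k) = vecMulVec (η (Pi.single i 1) • w₀ + t • mv) (Pi.single j 1) := by
      rw [← hei]
      clear ht hei
      ext r c
      simp only [single_apply, vecMulVec_apply, Pi.single_apply, mul_ite, mul_one, mul_zero]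
      by_cases hr : i = r <;> by_cases hc : j = c <;> simp [hr, hc, eq_comm]
    have hlin : vecMulVec (η (Pi.single i 1) • w₀ + t • mv) (Pi.single j (1 : k)) =
        η (Pi.single i 1) • vecMulVec w₀ (Pi.single j 1) + t • vecMulVec mv (Pi.single j 1) := by
      ext r c
      simp only [vecMulVec_apply, Pi.add_apply, Pi.smul_apply, smul_eq_mul, Matrix.add_apply, Matrix.smul_apply]
      ring
    rw [single_one_mulVec, map_smul, smul_eq_mul, hmat, hlin, map_add, map_smul, map_smul, hφ, smul_zero, add_zero,
      smul_eq_mul, mul_comm]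
  -- expand `X` on the unit matrices
  have hL : ∀ Y : Matrix (Fin 2) (Fin 2) k, (η.comp ((Matrix.mulVecBilin k k).flip u)) Y = η (Y *ᵥ u) :=
    fun Y => eta_comp_mulVec_apply η u Y
  rw [← hL, matrix_eq_sum_single X, map_sum, map_sum]
  refine Finset.sum_congr rfl fun i _ => ?_
  rw [map_sum, map_sum]
  refine Finset.sum_congr rfl fun j _ => ?_
  rw [show single i j (X i j) = X i j • single i j (1 : k) by rw [smul_single, smul_eq_mul, mul_one], map_smul, map_smul,
    hL, hsingle]

/-- Contrapositive: a functional that is NOT η-special takes a nonzero value at some `m λᵀ`. -/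
theorem exists_vecMulVec_apply_ne_zero (η : Module.Dual k (Fin 2 → k)) (hη : η ≠ 0) {mv : Fin 2 → k} (hm0 : mv ≠ 0)
    (hηm : η mv = 0) (φ : Module.Dual k (Matrix (Fin 2) (Fin 2) k)) (hφ : ¬ ∃ u : Fin 2 → k, ∀ X, φ X = η (X *ᵥ u)) :
    ∃ lam : Fin 2 → k, φ (vecMulVec mv lam) ≠ 0 := by
  by_contra h
  push Not at h
  exact hφ (etaSpecial_of_forall_vecMulVec_eq_zero η hη hm0 hηm φ h)

end FinTwo

end Summit.MatrixMultiplication.OmegaCensus.SmallFormats
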